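import Mathlib
import Summits.Ventures.PercRepro2.KPrimeReduction
import Summits.Ventures.PercRepro2.KPrimeSure
import Summits.Ventures.PercRepro2.KPrimeInduction
import Summits.Ventures.PercRepro2.KPrimeVEdge
import Summits.Ventures.PercRepro2.KPrimeVBase

/-!
# The `v`-exploration of `(K′)`: `(STEP-v′) ⟹ (K′)` — `KPrime.kprime_of_vstep`
(blind cell PercRepro2, mine-c g33; `conjectures/MINE-C.md` §42)

The lemma of record `(K′)` (`KPrime.kprimeForm`, `KPrimeReduction.lean`) follows from the ONE-EDGE
implication `(STEP-v′)` at the edges of the weight-`1` root of `v`: for an unresolved edge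
`e = {x, z}` with `x` in the root of `v` and `z` outside the roots of `v`, `a₁` and `a₂`,

  `(STEP-v′)  (K′)(p[e ↦ 0]) → (K′)(p[e ↦ 1]) → (K′)(p)`.

**Theorem** (`kprime_of_vstep`): `(STEP-v′)` for every instance implies `(K′)` for every instance,
by strong induction on the number of unresolved edges: an unresolved edge at the root of `v` into
the root of `a₁` / of `a₂` is resolved unconditionally (`kprimeHolds_of_update_zero_va₁` / `_va₂`,
`KPrimeVEdge.lean`), any other unresolved edge at the root of `v` by `(STEP-v′)`; when none is left
the root of `v` is exhausted and `kprime_of_exhausted_v` applies (`KPrimeVBase.lean`), the cases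
`a₁` / `a₂` in the root of `v` being degenerate.

`(STEP-v′)` is NOT proved here.  Its brace form «the mixture defect of `Φ_K` is `≥ 0` at every
`v`-root edge» is FALSE by a hair (mine-c g33, `MINE-C.md` §42.1: `c7_00497`, defect
`−4.268·10⁻¹⁰` against `Φ_K = 1.6·10⁻³`), while the fixed-threshold part of the defect is signed by
`(K′)` for the far end `z` itself (§42.2) — so this file is the kernel form of the `v`-exploration
FRAME: its base case, degenerate cases and the two special edges are unconditional, and what is
left is the threshold-mismatch margin of `(K′)` along a `v`-root edge.
-/

namespace Summit.Ventures.PercRepro2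

namespace KPrime

variable {V : Type*} {E : Type*} [Fintype E] [DecidableEq E] [Fintype V] [DecidableEq V]
  {R : Type*} [Field R] [LinearOrder R] [IsStrictOrderedRing R]

section VInduction

variable (ends : E → Sym2 V) (a₁ a₂ b v y : V)

/-- An UNRESOLVED `v`-ROOT EDGE: `e = {x, z}` with `x` in the weight-`1` root of `v`, `z` outside
the roots of `v`, `a₁` and `a₂`, and `p e ∉ {0, 1}` — the edges the `v`-exploration resolves by
`(STEP-v′)`. -/
def IsUnresolvedVRootEdge (p : E → R) (e : E) : Prop :=
  ∃ x z, ends e = s(x, z) ∧ x ∈ root p ends v ∧ z ∉ root p ends v ∧ z ∉ root p ends a₁ ∧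
    z ∉ root p ends a₂ ∧ p e ≠ 0 ∧ p e ≠ 1

/-- **(STEP-v′)** — the one-edge statement of the `v`-exploration: at every instance and every
unresolved `v`-root edge `e`, `(K′)` for the two resolutions (`e` pinned closed / pinned open)
implies `(K′)` for the instance.  NOT proved here (`MINE-C.md` §42.1–42.3). -/
def StepV : Prop :=
  ∀ p : E → R, IsProbVec p → ∀ e, IsUnresolvedVRootEdge ends a₁ a₂ v p e →
    KPrimeHolds ends a₁ a₂ b v y (Function.update p e 0) →
      KPrimeHolds ends a₁ a₂ b v y (Function.update p e 1) →
        KPrimeHolds ends a₁ a₂ b v y p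

/-- **THE `v`-EXPLORATION**: `(STEP-v′)` for every instance implies `(K′)` for every instance.
Induction on the number of unresolved edges: an unresolved `v`-root edge is resolved by
`(STEP-v′)`; an unresolved edge from the root of `v` into the root of `a₁` (resp. `a₂`) by
`kprimeHolds_of_update_zero_va₁` (resp. `_va₂`); when none is left the root of `v` is exhausted and
`kprime_of_exhausted_v` applies (resp. the degenerate cases `a₁` / `a₂` in the root of `v`). -/
theorem kprime_of_vstep (hstep : StepV (R := R) ends a₁ a₂ b v y) :
    ∀ p : E → R, IsProbVec p → KPrimeHolds ends a₁ a₂ b v y p := by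
  intro p
  induction' hn : unres p using Nat.strong_induction_on with n ih generalizing p
  intro hp
  by_cases h1r : a₁ ∈ root p ends v
  · exact kprimeHolds_of_a₁_mem_root_v h1r
  by_cases h2r : a₂ ∈ root p ends v
  · exact kprimeHolds_of_a₂_mem_root_v h2r
  by_cases hre : ∃ e, IsUnresolvedVRootEdge ends a₁ a₂ v p e
  · obtain ⟨e, x, z, hends, hx, hz, hz1, hz2, h0, h1⟩ := hre
    have ih0 := ih _ (hn ▸ unres_update_lt h0 h1 (Or.inl rfl)) (Function.update p e 0) rfl
      (hp.update e le_rfl zero_le_one)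
    have ih1 := ih _ (hn ▸ unres_update_lt h0 h1 (Or.inr rfl)) (Function.update p e 1) rfl
      (hp.update e zero_le_one le_rfl)
    exact hstep p hp e ⟨x, z, hends, hx, hz, hz1, hz2, h0, h1⟩ ih0 ih1
  simp only [not_exists] at hre
  by_cases hea : ∃ e x z, ends e = s(x, z) ∧ x ∈ root p ends v ∧ z ∈ root p ends a₁ ∧
      p e ≠ 0 ∧ p e ≠ 1
  · obtain ⟨e, x, z, hends, hx, hz, h0, h1⟩ := hea
    have ih0 := ih _ (hn ▸ unres_update_lt h0 h1 (Or.inl rfl)) (Function.update p e 0) rfl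
      (hp.update e le_rfl zero_le_one)
    exact kprimeHolds_of_update_zero_va₁ hp hends hx hz h1 ih0
  by_cases heb : ∃ e x z, ends e = s(x, z) ∧ x ∈ root p ends v ∧ z ∈ root p ends a₂ ∧
      p e ≠ 0 ∧ p e ≠ 1
  · obtain ⟨e, x, z, hends, hx, hz, h0, h1⟩ := heb
    have ih0 := ih _ (hn ▸ unres_update_lt h0 h1 (Or.inl rfl)) (Function.update p e 0) rfl
      (hp.update e le_rfl zero_le_one)
    exact kprimeHolds_of_update_zero_va₂ hp hends hx hz h1 ih0
  have hex : Exhausted p ends v := by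
    intro e x z hends hx hz
    by_contra h0
    have h1 : p e ≠ 1 := fun h1 => hz (mem_root_of_one p hends hx h1)
    by_cases hz1 : z ∈ root p ends a₁
    · exact hea ⟨e, x, z, hends, hx, hz1, h0, h1⟩
    by_cases hz2 : z ∈ root p ends a₂
    · exact heb ⟨e, x, z, hends, hx, hz2, h0, h1⟩
    exact hre e ⟨x, z, hends, hx, hz, hz1, hz2, h0, h1⟩
  exact kprime_of_exhausted_v hp hex h1r h2r

end VInduction

end KPrime

end Summit.Ventures.PercRepro2
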